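import Summits.HodgeConjecture.HodgeConjecture.Theorems.Ring2HypothesesDescentMotivatedBoxStar
import Summits.HodgeConjecture.HodgeConjecture.Theorems.Ring2HypothesesDescentMotivatedPullback
import Summits.HodgeConjecture.HodgeConjecture.Theorems.Ring2HypothesesDescentMotivatedUpperHalf
import Literature.AlgebraicGeometry.HodgeTheory.MotivatedClassesPushforward
import HarnessLib

/-!
# Ring 2 hypotheses, descent face — André's Prop. 2.1 (i) on the real carriers: MOTIVATED CLASSES ARE
# STABLE UNDER THE CUP PRODUCT (`A_mot(X)_ℂ` is a sub-algebra of `H²•(X(ℂ); ℂ)`)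

research route conditional on HC_CM; not a corollary; Q11.4-sentence-2 already refuted in dim ≥ 3.
Cell `pub-hodge-ring2` (Hodge ladder STAGE 3), seat `ring2-b05` (binder row b05
`Ring2.Hypotheses.MotivatedImpliesAlgebraicAV`), gen 35. `HC_CM` (`Theses.RankFourFaces.CMAbelianHodge`) does
not occur in this file; nothing here proves a case of the Hodge conjecture; the row b05 stays OPEN.

André 1996 (Publ. Math. IHÉS 83), Prop. 2.1 (i), p. 14: «`A_mot(X)_E` est une sous-`E`-algèbre de `H•(X)`
(relativement au cup-produit)»; proof p. 15: «Montrons la stabilité sous `∪`. On a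
`pr^{XY}_{X*}(α ∪ *β) ∪ pr^{XZ}_{X*}(γ ∪ *δ) = pr^{XYZX…}_{X*}([Δ] ∪ (α ⊗ γ) ∪ (*β ⊗ *δ))` et l'on conclut en appliquant
le lemme 1.3.2.» On the real carriers `HodgeTheory.motivatedClasses n X p = A_motᵖ(X)_ℂ` (André's Déf. 1 with an
arbitrary polarisation class of the auxiliary product `X ⊗ Y`) the tree had only the weak form
«motivated ∪ ALGEBRAIC is motivated» (`Theorems.cupProduct_mem_motivatedClasses_of_cupProduct_algebraic`). With
Lemme 1.3.2 on the real carriers (`cross_lefschetzInvolution_mem_sandwichSpan`, previous file) and the pull-back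
stability of motivated classes (`Theorems.map_mem_motivatedClasses`, the discharged leaf (A5)) the full statement
follows:

* §1 `sandwich_mem_motivatedClasses` — for polarisation classes `η₁`, `η₂` and algebraic `β₁ ∈ N^{b₁}(V)`,
  `β₂ ∈ N^{b₂}(W)` every one-star sandwich `𝓛₁ᵃ 𝓛₂ᵇ *_θ 𝓛₁ᶜ 𝓛₂ᵍ (β₁ ⊠ β₂)` is a motivated class of `V ⊗ W`
  (`θ = η₁ ⊞ η₂` is a polarisation class, `isPolarizationClass_boxSum`; `*_θ` of an algebraic class is a point
  generator, `lefschetzInvolution_mem_motivatedClasses`; `𝓛ᵢ` = cup product with a divisor class);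
  `cross_lefschetzInvolution_mem_motivatedClasses` — **`*_{η₁} β₁ ⊠ *_{η₂} β₂ ∈ A_mot(V ⊗ W)_ℂ`**;
* §2 `cupProduct_map_lefschetzInvolution_mem_motivatedClasses` — `φ₁^*(*_{η₁} β₁) ∪ φ₂^*(*_{η₂} β₂) ∈ A_mot(U)_ℂ`
  for morphisms `φ₁ : U ⟶ V`, `φ₂ : U ⟶ W` (pull back §1 along `(φ₁, φ₂) : U ⟶ V ⊗ W`);
* §3 `lefschetzInvolution_cupProduct_mem_motivatedClasses` — `*_η β ∪ w ∈ A_mot(X)_ℂ` for `w` motivated, `β`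
  algebraic, `η` any polarisation class of `X` (projection formula on a generator `w = pr_{X*}(α ∪ *_{η'} β')`,
  then §2 on `X ⊗ Y` with `φ₁ = 𝟙`, `φ₂ = pr_X`);
* §4 **`cupProduct_mem_motivatedClasses` — Prop. 2.1 (i): `A_motᵖ(X)_ℂ ∪ A_mot^{p'}(X)_ℂ ⊆ A_mot^{p+p'}(X)_ℂ`**, and
  the `Submodule.map₂` form `motivatedClasses_cupProduct_le`;
* §5 `corrClassAction_mem_motivatedClasses_of_motivated` — Corollaire (p. 15) in action form: a MOTIVATED
  correspondence class `u ∈ A_mot(W ⊗ X)_ℂ` maps `A_mot(X)_ℂ` into `A_mot(W)_ℂ`.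

No definition, no named fact, no sorry. Honest column: nothing here discharges a binder of the cell; c24
(`Andre1996_deformation`), X (`CompactAbelianPencilLefschetz`), row b05 and «10 · 0» are unmoved.
References: Andre1996Motifs (§1.3 Lemme 1.3.2 p. 13, §2.1 Déf. 1 and Prop. 2.1 pp. 14–15),
FultonYoungTableaux1997 (App. B §B.1 (5)–(7)), VoisinHodgeII2003 (§9.2.4 Prop. 9.20), HatcherAT2002 (§3.2).
-/

noncomputable section

-- every declaration of this problem lives in `Summit.HodgeConjecture.HodgeConjecture.…` (summit = sub-problem)
set_option linter.dupNamespace false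

open CategoryTheory AlgebraicGeometry MonoidalCategory CartesianMonoidalCategory
open Literature.AlgebraicTopology.SingularHomology Literature.Geometry.Kaehler
open Literature.AlgebraicGeometry Literature.AlgebraicGeometry.Motives
  Literature.AlgebraicGeometry.HodgeTheory

namespace Summit.HodgeConjecture.HodgeConjecture.Theorems

/-! ## §1 Sandwiches of algebraic classes are motivated; `*_{η₁} β₁ ⊠ *_{η₂} β₂ ∈ A_mot(V ⊗ W)` -/

section Sandwich

variable {d₁ d₂ : ℕ} {V W : SchemeOver ℂ} {η₁ : complexBetti V 2} {η₂ : complexBetti W 2}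

/-- Re-spelling the source degree of an iterated Lefschetz operator applied to a cup product (the class
`Lᵍ (a ∪ b)` does not depend on how the degree of `a ∪ b` is written). [folklore] -/
theorem lefschetzPowTo_cupProduct_congr {U : SchemeOver ℂ} (κ : complexBetti U 2) {i j d d' N : ℕ}
    (h₁ : i + j = d) (h₂ : i + j = d') (g : ℕ) (hg : d + 2 * g = N) (hg' : d' + 2 * g = N)
    (a : complexBetti U i) (b : complexBetti U j) :
    lefschetzPowTo κ g d N hg (cupProduct h₁ a b) = lefschetzPowTo κ g d' N hg' (cupProduct h₂ a b) := by
  subst h₁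
  subst h₂
  rfl

/-- **One-star sandwiches of algebraic classes are motivated.** For `V`, `W` smooth projective of dimensions
`d₁`, `d₂` with polarisation classes `η₁`, `η₂`, algebraic `β₁ ∈ N^{b₁} H^{2b₁}(V(ℂ))`, `β₂ ∈ N^{b₂} H^{2b₂}(W(ℂ))`
and `θ = fst^* η₁ + snd^* η₂` (a polarisation class of the `(d₁+d₂)`-fold `V ⊗ W`, `isPolarizationClass_boxSum`),
every sandwich `𝓛₁ᵃ 𝓛₂ᵇ *_θ 𝓛₁ᶜ 𝓛₂ᵍ (β₁ ⊠ β₂)` of degree `2r` lies in `A_motʳ(V ⊗ W)_ℂ`: `β₁ ⊠ β₂` is algebraic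
(flat pull-backs, multiplicativity of algebraic classes `Voisin2003_cupProduct_algebraicClasses_holds`), `𝓛₁ᶜ 𝓛₂ᵍ`
keep it algebraic (cup product with the divisor classes `fst^* η₁`, `snd^* η₂`), `*_θ` of an algebraic class is
one of André's generators with the point as auxiliary variety (`lefschetzInvolution_mem_motivatedClasses`), and
`𝓛₁ᵃ 𝓛₂ᵇ` preserve motivated classes (`lefschetzPowTo_mem_motivatedClasses_of_mem`).
[cite: Andre1996Motifs, §2.1 Déf. 1 and remark (p. 14)] [cite: VoisinHodgeII2003, §9.2.4 Prop. 9.20] -/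
theorem sandwich_mem_motivatedClasses (hV : IsSmoothProjective d₁ V) (hW : IsSmoothProjective d₂ W)
    (hη₁ : IsPolarizationClass d₁ V η₁) (hη₂ : IsPolarizationClass d₂ W η₂) {b₁ b₂ : ℕ}
    {β₁ : complexBetti V (2 * b₁)} {β₂ : complexBetti W (2 * b₂)} (hβ₁ : β₁ ∈ algebraicClasses V b₁)
    (hβ₂ : β₂ ∈ algebraicClasses W b₂) (a b c g N₁ M M' N₂ : ℕ) {r : ℕ} (hg : 2 * b₁ + 2 * b₂ + 2 * g = N₁)
    (hc : N₁ + 2 * c = M) (hMM' : M + M' = 2 * (d₁ + d₂)) (hb : M' + 2 * b = N₂) (ha : N₂ + 2 * a = 2 * r) :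
    lefschetzPowTo (complexBetti.map (fst V W) 2 η₁) a N₂ (2 * r) ha
        (lefschetzPowTo (complexBetti.map (snd V W) 2 η₂) b M' N₂ hb
          (lefschetzInvolution (isPolarizationClass_boxSum hV hW hη₁ hη₂).hasHardLefschetz hMM'
            (lefschetzPowTo (complexBetti.map (fst V W) 2 η₁) c N₁ M hc
              (lefschetzPowTo (complexBetti.map (snd V W) 2 η₂) g (2 * b₁ + 2 * b₂) N₁ hg
                (cupProduct rfl (complexBetti.map (fst V W) (2 * b₁) β₁)
                  (complexBetti.map (snd V W) (2 * b₂) β₂)))))) ∈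
      motivatedClasses (d₁ + d₂) (V ⊗ W) r := by
  have hP : IsSmoothProjective (d₁ + d₂) (V ⊗ W) := IsSmoothProjective.tensor_holds hV hW
  have hθ := isPolarizationClass_boxSum hV hW hη₁ hη₂
  have hθ₁ : complexBetti.map (fst V W) 2 η₁ ∈ algebraicClasses (V ⊗ W) 1 :=
    map_fst_mem_supportedClasses hV hW hη₁.mem_algebraicClasses
  have hθ₂ : complexBetti.map (snd V W) 2 η₂ ∈ algebraicClasses (V ⊗ W) 1 :=
    map_snd_mem_supportedClasses hV hW hη₂.mem_algebraicClasses
  -- canonical (even) spellings of the degrees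
  obtain rfl : N₁ = 2 * (b₁ + b₂ + g) := by omega
  obtain rfl : M = 2 * (b₁ + b₂ + g + c) := by omega
  obtain ⟨e, he⟩ : ∃ e, b₁ + b₂ + g + c + e = d₁ + d₂ := ⟨d₁ + d₂ - (b₁ + b₂ + g + c), by omega⟩
  obtain rfl : M' = 2 * e := by omega
  obtain rfl : N₂ = 2 * (e + b) := by omega
  obtain rfl : r = e + b + a := by omega
  -- `β₁ ⊠ β₂` and `𝓛₁ᶜ 𝓛₂ᵍ (β₁ ⊠ β₂)` are algebraic
  have h0 : cupProduct (two_mul_add_two_mul b₁ b₂) (complexBetti.map (fst V W) (2 * b₁) β₁)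
      (complexBetti.map (snd V W) (2 * b₂) β₂) ∈ algebraicClasses (V ⊗ W) (b₁ + b₂) :=
    Voisin2003_cupProduct_algebraicClasses_holds hP (map_fst_mem_supportedClasses hV hW hβ₁)
      (map_snd_mem_supportedClasses hV hW hβ₂)
  have hg' : 2 * (b₁ + b₂) + 2 * g = 2 * (b₁ + b₂ + g) := by omega
  have h1 : lefschetzPowTo (complexBetti.map (snd V W) 2 η₂) g (2 * (b₁ + b₂)) (2 * (b₁ + b₂ + g)) hg'
      (cupProduct (two_mul_add_two_mul b₁ b₂) (complexBetti.map (fst V W) (2 * b₁) β₁)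
        (complexBetti.map (snd V W) (2 * b₂) β₂)) ∈ algebraicClasses (V ⊗ W) (b₁ + b₂ + g) :=
    lefschetzPowTo_mem_algebraicClasses_of_cupProduct Voisin2003_cupProduct_algebraicClasses_holds hP hθ₂ g
      (b₁ + b₂) hg' h0
  have h2 := lefschetzPowTo_mem_algebraicClasses_of_cupProduct Voisin2003_cupProduct_algebraicClasses_holds hP
    hθ₁ c (b₁ + b₂ + g) hc h1
  -- `*_θ` of it is a point generator, and `𝓛₁ᵃ 𝓛₂ᵇ` keep it motivated
  have h3 := lefschetzInvolution_mem_motivatedClasses hP hθ he hMM' h2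
  have h4 := Ring2.Hypotheses.lefschetzPowTo_mem_motivatedClasses_of_mem hP hθ₂ b e hb h3
  have h5 := Ring2.Hypotheses.lefschetzPowTo_mem_motivatedClasses_of_mem hP hθ₁ a (e + b) ha h4
  rw [lefschetzPowTo_cupProduct_congr (complexBetti.map (snd V W) 2 η₂) rfl (two_mul_add_two_mul b₁ b₂) g hg hg']
  exact h5

/-- **`*_{η₁} β₁ ⊠ *_{η₂} β₂ ∈ A_mot(V ⊗ W)_ℂ`** — the case of André's Prop. 2.1 (i) on which everything rests
(«`*β ⊗ *δ` … et l'on conclut en appliquant le lemme 1.3.2», p. 15): for polarisation classes `η₁`, `η₂` of the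
smooth projective `V`, `W` and algebraic `β₁ ∈ N^{b₁}(V)`, `β₂ ∈ N^{b₂}(W)` (`bᵢ + bᵢ' = dᵢ`), the cross product
`fst^*(*_{η₁} β₁) ∪ snd^*(*_{η₂} β₂)` is a motivated class of `V ⊗ W`: by Lemme 1.3.2
(`cross_lefschetzInvolution_mem_sandwichSpan`) it is a combination of sandwiches, each motivated
(`sandwich_mem_motivatedClasses`). [cite: Andre1996Motifs, §1.3 Lemme 1.3.2 (p. 13) and proof of Prop. 2.1 (p. 15)] -/
theorem cross_lefschetzInvolution_mem_motivatedClasses (hV : IsSmoothProjective d₁ V)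
    (hW : IsSmoothProjective d₂ W) (hη₁ : IsPolarizationClass d₁ V η₁) (hη₂ : IsPolarizationClass d₂ W η₂)
    {b₁ b₁' b₂ b₂' r : ℕ} (h₁ : 2 * b₁ + 2 * b₁' = 2 * d₁) (h₂ : 2 * b₂ + 2 * b₂' = 2 * d₂)
    (hT : 2 * b₁' + 2 * b₂' = 2 * r) {β₁ : complexBetti V (2 * b₁)} {β₂ : complexBetti W (2 * b₂)}
    (hβ₁ : β₁ ∈ algebraicClasses V b₁) (hβ₂ : β₂ ∈ algebraicClasses W b₂) :
    cupProduct hT (complexBetti.map (fst V W) (2 * b₁') (lefschetzInvolution hη₁.hasHardLefschetz h₁ β₁))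
        (complexBetti.map (snd V W) (2 * b₂') (lefschetzInvolution hη₂.hasHardLefschetz h₂ β₂)) ∈
      motivatedClasses (d₁ + d₂) (V ⊗ W) r := by
  refine (Submodule.span_le.2 ?_) (cross_lefschetzInvolution_mem_sandwichSpan hV hW hη₁.hasHardLefschetz
    hη₂.hasHardLefschetz (isPolarizationClass_boxSum hV hW hη₁ hη₂).hasHardLefschetz h₁ h₂ hT β₁ β₂)
  rintro z ⟨a, b, c, g, N₁, M, M', N₂, hg, hc, hMM', hb, ha, rfl⟩
  exact sandwich_mem_motivatedClasses hV hW hη₁ hη₂ hβ₁ hβ₂ a b c g N₁ M M' N₂ hg hc hMM' hb ha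

end Sandwich

/-! ## §2 Two starred algebraic classes pulled back to a common variety -/

/-- **`φ₁^*(*_{η₁} β₁) ∪ φ₂^*(*_{η₂} β₂) ∈ A_mot(U)_ℂ`**: for smooth projective `U`, `V`, `W`, morphisms
`φ₁ : U ⟶ V`, `φ₂ : U ⟶ W`, polarisation classes `η₁` of `V`, `η₂` of `W` and algebraic `β₁`, `β₂`, the cup product
on `U` of the two pulled-back starred classes is motivated: it is the pull-back of
`*_{η₁} β₁ ⊠ *_{η₂} β₂ ∈ A_mot(V ⊗ W)` (`cross_lefschetzInvolution_mem_motivatedClasses`) along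
`(φ₁, φ₂) : U ⟶ V ⊗ W`, and motivated classes are stable under pull-backs (André Prop. 2.1 (ii) with p. 15, the
tree's `Theorems.map_mem_motivatedClasses`). [cite: Andre1996Motifs, Prop. 2.1 (p. 14) and p. 15] -/
theorem cupProduct_map_lefschetzInvolution_mem_motivatedClasses {n d₁ d₂ : ℕ} {U V W : SchemeOver ℂ}
    (hU : IsSmoothProjective n U) (hV : IsSmoothProjective d₁ V) (hW : IsSmoothProjective d₂ W)
    (φ₁ : U ⟶ V) (φ₂ : U ⟶ W) {η₁ : complexBetti V 2} {η₂ : complexBetti W 2}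
    (hη₁ : IsPolarizationClass d₁ V η₁) (hη₂ : IsPolarizationClass d₂ W η₂) {b₁ b₁' b₂ b₂' r : ℕ}
    (h₁ : 2 * b₁ + 2 * b₁' = 2 * d₁) (h₂ : 2 * b₂ + 2 * b₂' = 2 * d₂) (hT : 2 * b₁' + 2 * b₂' = 2 * r)
    {β₁ : complexBetti V (2 * b₁)} {β₂ : complexBetti W (2 * b₂)} (hβ₁ : β₁ ∈ algebraicClasses V b₁)
    (hβ₂ : β₂ ∈ algebraicClasses W b₂) :
    cupProduct hT (complexBetti.map φ₁ (2 * b₁') (lefschetzInvolution hη₁.hasHardLefschetz h₁ β₁))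
        (complexBetti.map φ₂ (2 * b₂') (lefschetzInvolution hη₂.hasHardLefschetz h₂ β₂)) ∈
      motivatedClasses n U r := by
  have hP : IsSmoothProjective (d₁ + d₂) (V ⊗ W) := IsSmoothProjective.tensor_holds hV hW
  have hφ₁ : ∀ (i : ℕ) (s : complexBetti V i), complexBetti.map (lift φ₁ φ₂) i (complexBetti.map (fst V W) i s) =
      complexBetti.map φ₁ i s := fun i s ↦ by
    rw [← CategoryTheory.comp_apply, ← complexBetti.map_comp, lift_fst]
  have hφ₂ : ∀ (i : ℕ) (s : complexBetti W i), complexBetti.map (lift φ₁ φ₂) i (complexBetti.map (snd V W) i s) =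
      complexBetti.map φ₂ i s := fun i s ↦ by
    rw [← CategoryTheory.comp_apply, ← complexBetti.map_comp, lift_snd]
  have key := map_mem_motivatedClasses (lift φ₁ φ₂) hP hU r
    (cross_lefschetzInvolution_mem_motivatedClasses hV hW hη₁ hη₂ h₁ h₂ hT hβ₁ hβ₂)
  rwa [cupProduct_map, hφ₁, hφ₂] at key

/-! ## §3 A starred algebraic class times a motivated class -/

section Projection

variable {n : ℕ} {X : SchemeOver ℂ}

/-- **Projection formula on a generator** (Fulton App. B (6), `pr_{X*}(w) ∪ z = pr_{X*}(w ∪ pr_X^* z)`, with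
associativity): for generator data `(Y, μ, ν, η', α, β')` of `A_motᵖ(X)_ℂ` and `z ∈ H^{2p'}(X(ℂ); ℂ)` with
`p + p' = r`, `r + q' = n`:
`pr_{X*}(α ∪ *_{η'} β') ∪ z = pr_{X*}(α ∪ (*_{η'} β' ∪ pr_X^* z))`. [cite: FultonYoungTableaux1997, Appendix B §B.1 (6)]
[cite: HatcherAT2002, §3.2] -/
theorem cupProduct_gysinMap_generator_eq (hX : IsSmoothProjective n X) {p m : ℕ} {Y : SchemeOver ℂ}
    (μ : HomologicalOrientation ℂ (ComplexPoints (X ⊗ Y)) (2 * (n + m)))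
    (ν : HomologicalOrientation ℂ (ComplexPoints X) (2 * n)) (hν : ν.HasPoincareDuality)
    {η : complexBetti (X ⊗ Y) 2} (hη : IsPolarizationClass (n + m) (X ⊗ Y) η) {a b b' q : ℕ}
    (hbb' : b + b' = n + m) (hab : a + b' = p + m) (hq : p + q = n) (α : complexBetti (X ⊗ Y) (2 * a))
    (β : complexBetti (X ⊗ Y) (2 * b)) {p' r q' : ℕ} (hr : p + p' = r) (hrq : r + q' = n)
    (h : 2 * p + 2 * p' = 2 * r) (z : complexBetti X (2 * p')) :
    cupProduct h (gysinMap μ ν (AlgPoints.mapContinuous (L := ℂ) (fst X Y))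
        (show 2 * (p + m) + 2 * q = 2 * (n + m) by omega) (show 2 * p + 2 * q = 2 * n by omega)
        (cupProduct (show 2 * a + 2 * b' = 2 * (p + m) by omega) α
          (lefschetzInvolution hη.hasHardLefschetz (show 2 * b + 2 * b' = 2 * (n + m) by omega) β))) z =
      gysinMap μ ν (AlgPoints.mapContinuous (L := ℂ) (fst X Y))
        (show 2 * (r + m) + 2 * q' = 2 * (n + m) by omega) (show 2 * r + 2 * q' = 2 * n by omega)
        (cupProduct (show 2 * a + 2 * (b' + p') = 2 * (r + m) by omega) α
          (cupProduct (two_mul_add_two_mul b' p')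
            (lefschetzInvolution hη.hasHardLefschetz (show 2 * b + 2 * b' = 2 * (n + m) by omega) β)
            (complexBetti.map (fst X Y) (2 * p') z))) := by
  have _ := hX
  rw [← gysinMap_cupProduct_map hν (AlgPoints.mapContinuous (L := ℂ) (fst X Y))
      (show 2 * (p + m) + 2 * p' = 2 * (r + m) by omega)
      (show 2 * (r + m) + 2 * q' = 2 * (n + m) by omega) (show 2 * r + 2 * q' = 2 * n by omega)
      (show 2 * p' + 2 * q' = 2 * q by omega) _ _ h,
    cupProduct_assoc (show 2 * a + 2 * b' = 2 * (p + m) by omega) (two_mul_add_two_mul b' p')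
      (show 2 * (p + m) + 2 * p' = 2 * (r + m) by omega) (show 2 * a + 2 * (b' + p') = 2 * (r + m) by omega)]

/-- **An algebraic class times a motivated class is motivated, algebraic factor on the left** (the weak
Prop. 2.1 (i) of the tree, `cupProduct_mem_motivatedClasses_of_cupProduct_algebraic`, after graded commutativity
in even degrees). [cite: Andre1996Motifs, Prop. 2.1 (i) (p. 14)] -/
theorem cupProduct_mem_motivatedClasses_of_algebraic_left (hX : IsSmoothProjective n X) {c a e : ℕ}
    (h : 2 * c + 2 * a = 2 * e) {γ : complexBetti X (2 * c)} (hγ : γ ∈ algebraicClasses X c)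
    {x : complexBetti X (2 * a)} (hx : x ∈ motivatedClasses n X a) :
    cupProduct h γ x ∈ motivatedClasses n X e := by
  rw [cupProduct_gradedComm_holds ℂ (ComplexPoints X) h (show 2 * a + 2 * c = 2 * e by omega),
    Even.neg_one_pow ((even_two_mul c).mul_right (2 * a)), one_smul]
  exact cupProduct_mem_motivatedClasses_of_cupProduct_algebraic Voisin2003_cupProduct_algebraicClasses_holds hX
    _ hx hγ

/-- **`pr_{X*}(α ∪ w) ∈ A_motʳ(X)_ℂ` for `α` algebraic and `w` motivated on `X ⊗ Y`** (algebraic ∪ motivated is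
motivated, and `pr_{X*}` preserves motivated classes — André Prop. 2.1 (ii), second inclusion, the tree's
`gysinMap_fst_mem_motivatedClasses`). [cite: Andre1996Motifs, Prop. 2.1 (p. 14) and proof (p. 15)] -/
theorem gysinMap_cupProduct_mem_motivatedClasses (hX : IsSmoothProjective n X) {m : ℕ} {Y : SchemeOver ℂ}
    (hY : IsSmoothProjective m Y) (μ : HomologicalOrientation ℂ (ComplexPoints (X ⊗ Y)) (2 * (n + m)))
    (ν : HomologicalOrientation ℂ (ComplexPoints X) (2 * n)) (hμ : μ.HasPoincareDuality)
    (hν : ν.HasPoincareDuality) {a e r q' : ℕ}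
    (H₁ : 2 * (r + m) + 2 * q' = 2 * (n + m)) (H₂ : 2 * r + 2 * q' = 2 * n) (h : 2 * a + 2 * e = 2 * (r + m))
    {α : complexBetti (X ⊗ Y) (2 * a)} (hα : α ∈ algebraicClasses (X ⊗ Y) a)
    {w : complexBetti (X ⊗ Y) (2 * e)} (hw : w ∈ motivatedClasses (n + m) (X ⊗ Y) e) :
    gysinMap μ ν (AlgPoints.mapContinuous (L := ℂ) (fst X Y)) H₁ H₂ (cupProduct h α w) ∈
      motivatedClasses n X r :=
  gysinMap_fst_mem_motivatedClasses hX hY μ ν hμ hν H₁ H₂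
    (cupProduct_mem_motivatedClasses_of_algebraic_left (IsSmoothProjective.tensor_holds hX hY) h hα hw)

/-- **A starred algebraic class times a motivated class is motivated**: for `X` smooth projective of dimension
`n`, `η` ANY polarisation class of `X`, `β ∈ Nᵇ H²ᵇ(X(ℂ); ℂ)` algebraic (`b + b' = n`) and `w ∈ A_motᵖ(X)_ℂ`,
`*_η β ∪ w ∈ A_mot^{b'+p}(X)_ℂ`. On a generator `w = pr_{X*}(α ∪ *_{η'} β')` (auxiliary `Y`, polarisation `η'` of
`X ⊗ Y`): `*_η β ∪ w = w ∪ *_η β = pr_{X*}(α ∪ (*_{η'} β' ∪ pr_X^*(*_η β)))` (graded commutativity in even degrees,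
projection formula), and `*_{η'} β' ∪ pr_X^*(*_η β) = 𝟙^*(*_{η'} β') ∪ pr_X^*(*_η β)` is motivated on `X ⊗ Y` by
`cupProduct_map_lefschetzInvolution_mem_motivatedClasses` — this is where Lemme 1.3.2 enters.
[cite: Andre1996Motifs, Prop. 2.1 (i) (p. 14) and proof (p. 15)] [cite: FultonYoungTableaux1997, Appendix B §B.1 (6)] -/
theorem lefschetzInvolution_cupProduct_mem_motivatedClasses (hX : IsSmoothProjective n X)
    {η : complexBetti X 2} (hη : IsPolarizationClass n X η) {b b' p r : ℕ}
    (h₄ : 2 * b + 2 * b' = 2 * n) (h : 2 * b' + 2 * p = 2 * r) {β : complexBetti X (2 * b)}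
    (hβ : β ∈ algebraicClasses X b) {w : complexBetti X (2 * p)} (hw : w ∈ motivatedClasses n X p) :
    cupProduct h (lefschetzInvolution hη.hasHardLefschetz h₄ β) w ∈ motivatedClasses n X r := by
  classical
  -- above the top degree everything vanishes
  by_cases hr : n < r
  · haveI := subsingleton_complexBetti hX (show 2 * n < 2 * r by omega)
    rw [Subsingleton.elim (cupProduct h _ w) 0]
    exact Submodule.zero_mem _
  obtain ⟨q', hrq⟩ : ∃ q', r + q' = n := ⟨n - r, by omega⟩
  -- reduce to a generator `w`
  suffices hle : motivatedClasses n X p ≤ (motivatedClasses n X r).comap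
      (cupProduct h (lefschetzInvolution hη.hasHardLefschetz h₄ β)) from hle hw
  rw [motivatedClasses_le_iff]
  rintro y ⟨m, Y, hY, μ, ν, hμ, hν, η', hη', a, b₀, b₀', q, hbb₀, hab, hq, α, β', hα, hβ', rfl⟩
  rw [Submodule.mem_comap]
  have hXY : IsSmoothProjective (n + m) (X ⊗ Y) := IsSmoothProjective.tensor_holds hX hY
  -- `*_η β ∪ w = w ∪ *_η β = pr_{X*}(α ∪ (*_{η'} β' ∪ pr_X^*(*_η β)))`
  rw [cupProduct_gradedComm_holds ℂ (ComplexPoints X) h (show 2 * p + 2 * b' = 2 * r by omega),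
    Even.neg_one_pow ((even_two_mul b').mul_right (2 * p)), one_smul,
    cupProduct_gysinMap_generator_eq hX μ ν hν hη' hbb₀ hab hq α β' (show p + b' = r by omega) hrq]
  -- the inner class is motivated by §2 (`φ₁ = 𝟙`, `φ₂ = pr_X`)
  refine gysinMap_cupProduct_mem_motivatedClasses hX hY μ ν hμ hν _ _ _ hα ?_
  have key := cupProduct_map_lefschetzInvolution_mem_motivatedClasses hXY hXY hX (𝟙 (X ⊗ Y)) (fst X Y) hη' hη
    (show 2 * b₀ + 2 * b₀' = 2 * (n + m) by omega) h₄ (two_mul_add_two_mul b₀' b') hβ' hβ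
  rwa [complexBetti.map_id, ModuleCat.id_apply] at key

end Projection

/-! ## §4 Prop. 2.1 (i): `A_mot(X)_ℂ` is stable under the cup product -/

/-- **André's Prop. 2.1 (i) on the real carriers: motivated classes are stable under the cup product.** For `X`
smooth projective of dimension `n` over `ℂ`, `x ∈ A_motᵖ(X)_ℂ` and `x' ∈ A_mot^{p'}(X)_ℂ`
(`HodgeTheory.motivatedClasses`), `x ∪ x' ∈ A_mot^{p+p'}(X)_ℂ`. On a generator `x = pr_{X*}(α ∪ *_{η'} β')`
(auxiliary `Y`): `x ∪ x' = pr_{X*}(α ∪ (*_{η'} β' ∪ pr_X^* x'))` (projection formula), `pr_X^* x'` is motivated on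
`X ⊗ Y` (Prop. 2.1 (ii), first inclusion, `Theorems.map_fst_mem_motivatedClasses`), `*_{η'} β' ∪ pr_X^* x'` is
motivated (`lefschetzInvolution_cupProduct_mem_motivatedClasses`, i.e. Lemme 1.3.2), so is `α ∪ (…)`, and
`pr_{X*}` preserves motivated classes. André: «`pr_*(α ∪ *β) ∪ pr_*(γ ∪ *δ) = pr_*([Δ] ∪ (α ⊗ γ) ∪ (*β ⊗ *δ))`
et l'on conclut en appliquant le lemme 1.3.2». [cite: Andre1996Motifs, Prop. 2.1 (i) (p. 14) and proof (p. 15)] -/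
theorem cupProduct_mem_motivatedClasses {n : ℕ} {X : SchemeOver ℂ} (hX : IsSmoothProjective n X)
    {p p' r : ℕ} (h : 2 * p + 2 * p' = 2 * r) {x : complexBetti X (2 * p)} (hx : x ∈ motivatedClasses n X p)
    {x' : complexBetti X (2 * p')} (hx' : x' ∈ motivatedClasses n X p') :
    cupProduct h x x' ∈ motivatedClasses n X r := by
  classical
  by_cases hr : n < r
  · haveI := subsingleton_complexBetti hX (show 2 * n < 2 * r by omega)
    rw [Subsingleton.elim (cupProduct h x x') 0]
    exact Submodule.zero_mem _
  obtain ⟨q', hrq⟩ : ∃ q', r + q' = n := ⟨n - r, by omega⟩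
  -- reduce to a generator `x`
  suffices hle : motivatedClasses n X p ≤ (motivatedClasses n X r).comap ((cupProduct h).flip x') from hle hx
  rw [motivatedClasses_le_iff]
  rintro y ⟨m, Y, hY, μ, ν, hμ, hν, η', hη', a, b₀, b₀', q, hbb₀, hab, hq, α, β', hα, hβ', rfl⟩
  rw [Submodule.mem_comap, LinearMap.flip_apply]
  have hXY : IsSmoothProjective (n + m) (X ⊗ Y) := IsSmoothProjective.tensor_holds hX hY
  -- `x ∪ x' = pr_{X*}(α ∪ (*_{η'} β' ∪ pr_X^* x'))`
  rw [cupProduct_gysinMap_generator_eq hX μ ν hν hη' hbb₀ hab hq α β' (show p + p' = r by omega) hrq]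
  refine gysinMap_cupProduct_mem_motivatedClasses hX hY μ ν hμ hν _ _ _ hα ?_
  -- `*_{η'} β' ∪ pr_X^* x'` is motivated on `X ⊗ Y`
  exact lefschetzInvolution_cupProduct_mem_motivatedClasses hXY hη' _ _ hβ' (map_fst_mem_motivatedClasses hX hY p' hx')

/-- **Prop. 2.1 (i), sub-algebra form**: `A_motᵖ(X)_ℂ ∪ A_mot^{p'}(X)_ℂ ⊆ A_mot^{p+p'}(X)_ℂ` as an inclusion of
`ℂ`-subspaces of `H^{2(p+p')}(X(ℂ); ℂ)` (`Submodule.map₂` of the cup product). With `A(X) ⊆ A_mot(X)`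
(`algebraicClasses_le_motivatedClasses`) and `1 ∈ A⁰(X)`, `A_mot^•(X)_ℂ = ⨁ₚ A_motᵖ(X)_ℂ` is a unital graded
sub-`ℂ`-algebra of `H^{2•}(X(ℂ); ℂ)`. [cite: Andre1996Motifs, Prop. 2.1 (i) (p. 14)] -/
theorem motivatedClasses_cupProduct_le {n : ℕ} {X : SchemeOver ℂ} (hX : IsSmoothProjective n X)
    {p p' r : ℕ} (h : 2 * p + 2 * p' = 2 * r) :
    Submodule.map₂ (cupProduct h) (motivatedClasses n X p) (motivatedClasses n X p') ≤ motivatedClasses n X r :=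
  Submodule.map₂_le.2 fun _ hx _ hx' ↦ cupProduct_mem_motivatedClasses hX h hx hx'

/-! ## §5 Corollaire (André p. 15): motivated correspondences preserve motivated classes -/

/-- **`u^*(A_motᵖ(X)_ℂ) ⊆ A_mot^{p'}(W)_ℂ` for a MOTIVATED correspondence class `u ∈ A_motᵉ(W ⊗ X)_ℂ`** (André 1996,
Corollaire of Prop. 2.1, p. 15: «Les correspondances motivées se composent … les espaces de `E`-correspondances
motivées sont stables par la composition donnée par la formule `g ∘ f = pr_{13*}(pr_{12}^* f ∪ pr_{23}^* g)`», here in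
action form): `u^* c = pr_{W*}(pr_X^* c ∪ u)` (`corrClassAction`, any orientations with Poincaré duality) with
`pr_X^* c` motivated (Prop. 2.1 (ii), `Theorems.map_snd_mem_motivatedClasses`), `· ∪ u` motivated (Prop. 2.1 (i),
`cupProduct_mem_motivatedClasses`) and `pr_{W*}` preserving motivated classes (`gysinMap_fst_mem_motivatedClasses`).
The tree's `Ring2.Hypotheses.corrClassAction_mem_motivatedClasses` is the case of an ALGEBRAIC `u`.
Degrees: `2p + 2e = 2p' + 2n`, `2p' + 2q = 2m`. [cite: Andre1996Motifs, Prop. 2.1 and Corollaire (pp. 14–15)] -/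
theorem corrClassAction_mem_motivatedClasses_of_motivated {m n : ℕ} {W X : SchemeOver ℂ}
    (hW : IsSmoothProjective m W) (hX : IsSmoothProjective n X)
    (μ : HomologicalOrientation ℂ (ComplexPoints (W ⊗ X)) (2 * (m + n)))
    (ν : HomologicalOrientation ℂ (ComplexPoints W) (2 * m)) (hμ : μ.HasPoincareDuality) (hν : ν.HasPoincareDuality)
    {e p p' q : ℕ} (hab : 2 * p + 2 * e = 2 * p' + 2 * n) (hq : 2 * p' + 2 * q = 2 * m)
    {u : complexBetti (W ⊗ X) (2 * e)} (hu : u ∈ motivatedClasses (m + n) (W ⊗ X) e)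
    {c : complexBetti X (2 * p)} (hc : c ∈ motivatedClasses n X p) :
    corrClassAction μ ν hab hq u c ∈ motivatedClasses m W p' := by
  have hWX : IsSmoothProjective (m + n) (W ⊗ X) := IsSmoothProjective.tensor_holds hW hX
  rw [corrClassAction_apply]
  have hsnd : complexBetti.map (snd W X) (2 * p) c ∈ motivatedClasses (m + n) (W ⊗ X) p :=
    map_snd_mem_motivatedClasses hX hW p hc
  have hcupm : ∀ (k : ℕ) (_ : p + e = k) (h2 : 2 * p + 2 * e = 2 * k),
      cupProduct h2 (complexBetti.map (snd W X) (2 * p) c) u ∈ motivatedClasses (m + n) (W ⊗ X) k := by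
    rintro k rfl h2
    exact cupProduct_mem_motivatedClasses hWX h2 hsnd hu
  have hk := hcupm (p' + n) (by omega) (by omega)
  -- degree bookkeeping `2p + 2e = 2(p' + n)`
  have key : ∀ {D : ℕ} (hD : 2 * p + 2 * e = D) (e1 : D + 2 * q = 2 * (m + n)),
      gysinMap μ ν (AlgPoints.mapContinuous (L := ℂ) (fst W X)) e1 hq
          (cupProduct hD (complexBetti.map (snd W X) (2 * p) c) u) =
        gysinMap μ ν (AlgPoints.mapContinuous (L := ℂ) (fst W X))
          (show 2 * p + 2 * e + 2 * q = 2 * (m + n) by omega) hq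
          (cupProduct rfl (complexBetti.map (snd W X) (2 * p) c) u) := by
    rintro D rfl e1
    rfl
  rw [← key (show 2 * p + 2 * e = 2 * (p' + n) by omega) (show 2 * (p' + n) + 2 * q = 2 * (m + n) by omega)]
  exact gysinMap_fst_mem_motivatedClasses hW hX μ ν hμ hν _ hq hk

end Summit.HodgeConjecture.HodgeConjecture.Theorems

end
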